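import Summits.QuantumFields.QCD.Theses.QuarksAsStableAction
import Literature.MathematicalPhysics.QuantumLattice.WilsonDiracRangeOne

/-!
# Row sums of the defect perturbation `D_W[U] − D_W[U′]`
(helper for crux stmt-QuantumFields-9737, line `Sketch`, card `sylvester-defect-floor`, stub
`wilsonDirac_sub_rowSum_le`)

For a unitary representation `ρ : G →* U(N)`, two gauge fields `U, U'` on the four-torus `(ℤ/L)⁴` with
`L ≥ 2`, a common bare mass `m` and Wilson parameter `r = 1`, the defect perturbation
`V = D_W[U] − D_W[U′]` entering the Sylvester factor `det(1 + χ V D′⁻¹ χ)` (identity landed as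
`det_wilsonDirac_eq_det_mul_det_defect`, p105792) has absolute row sums `Σ_q |V p q| ≤ 64 N`.
Proof: in `V` the mass diagonal cancels; for `L ≥ 2` no hop is on-site (`x + ê_μ ≠ x`), so every
same-site entry of `V` (`q.1 = p.1`) vanishes (both operators have the same same-site entries, the mass
diagonal), while the off-site part is bounded by the triangle inequality and twice the landed off-site
row-sum bound `wilsonDirac_offsite_rowSum_le` (`≤ 32 N` each).
[cite: MontvayMunster1994, §4.2 (4.85)].  Pure theorem file (no definitions).
-/

noncomputable section

namespace Summit.QuantumFields.QCD.Cruxes.StableActionBridge.Sketch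

open Finset
open Literature.MathematicalPhysics.QuantumLattice Literature.MathematicalPhysics.QuantumFieldTheory

namespace DefectRowSum

open Literature.Probability.LatticeModels (TorusSite)

variable {N L : ℕ} {G : Type*} [Group G] (ρ : G →* Matrix (Fin N) (Fin N) ℂ)

omit [Group G] in
/-- On a torus of side `L ≥ 2` a site is not its own neighbour: `x + ê_μ ≠ x`. -/
theorem site_shift_ne_self (hL : 2 ≤ L) (x : TorusSite 4 L) (μ : Fin 4) : Site.shift x μ ≠ x := by
  intro h
  have h1 := congrFun h μ
  simp only [Site.shift, Pi.add_apply, Pi.single_eq_same, add_eq_left] at h1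
  haveI : Fact (1 < L) := ⟨hL⟩
  exact one_ne_zero h1

/-- **Same-site entries of the defect perturbation vanish.**  For `L ≥ 2` no hop of `D_W` is on-site,
so for `p.1 = q.1` the `(p, q)` entries of `D_W[U]` and `D_W[U']` are both the mass diagonal. -/
theorem wilsonDirac_sub_apply_eq_zero_of_fst_eq (hL : 2 ≤ L) (U U' : GaugeConfig 4 L G) (m : ℝ)
    {p q : TorusSite 4 L × Fin N × Fin 4} (hpq : p.1 = q.1) :
    (wilsonDirac ρ U m 1 - wilsonDirac ρ U' m 1) p q = 0 := by
  have h1 : ∀ μ : Fin 4, ¬ q.1 = Site.shift p.1 μ := fun μ h =>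
    site_shift_ne_self hL p.1 μ (h.symm.trans hpq.symm)
  have h2 : ∀ μ : Fin 4, ¬ p.1 = Site.shift q.1 μ := fun μ h =>
    site_shift_ne_self hL q.1 μ (h.symm.trans hpq)
  rw [Matrix.sub_apply, sub_eq_zero]
  simp only [wilsonDirac, Matrix.of_apply, if_neg (h1 _), if_neg (h2 _)]

variable [NeZero L]

/-- **Row sums of the defect perturbation**: `Σ_q |(D_W[U] − D_W[U'])_{pq}| ≤ 64 N` for unitary `ρ`,
`L ≥ 2`, every mass `m` and `r = 1`. -/
theorem wilsonDirac_sub_rowSum_le' (hρ : ∀ g, ρ g ∈ Matrix.unitaryGroup (Fin N) ℂ) (hL : 2 ≤ L)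
    (U U' : GaugeConfig 4 L G) (m : ℝ) (p : TorusSite 4 L × Fin N × Fin 4) :
    ∑ q, ‖(wilsonDirac ρ U m 1 - wilsonDirac ρ U' m 1) p q‖ ≤ 64 * N := by
  have hoff : ∑ q ∈ univ.filter (fun q : TorusSite 4 L × Fin N × Fin 4 => p.1 ≠ q.1),
      ‖(wilsonDirac ρ U m 1 - wilsonDirac ρ U' m 1) p q‖ ≤ 32 * N + 32 * N := by
    calc _ ≤ ∑ q ∈ univ.filter (fun q : TorusSite 4 L × Fin N × Fin 4 => p.1 ≠ q.1),
          (‖wilsonDirac ρ U m 1 p q‖ + ‖wilsonDirac ρ U' m 1 p q‖) :=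
          Finset.sum_le_sum fun q _ => by rw [Matrix.sub_apply]; exact norm_sub_le _ _
      _ ≤ 32 * N + 32 * N := by
          rw [Finset.sum_add_distrib]
          exact add_le_add (wilsonDirac_offsite_rowSum_le ρ hρ U m p _ fun _ h => h)
            (wilsonDirac_offsite_rowSum_le ρ hρ U' m p _ fun _ h => h)
  have hon : ∑ q ∈ univ.filter (fun q : TorusSite 4 L × Fin N × Fin 4 => ¬ p.1 ≠ q.1),
      ‖(wilsonDirac ρ U m 1 - wilsonDirac ρ U' m 1) p q‖ = 0 := by
    refine Finset.sum_eq_zero fun q hq => ?_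
    have hq' : p.1 = q.1 := not_not.mp (Finset.mem_filter.mp hq).2
    rw [wilsonDirac_sub_apply_eq_zero_of_fst_eq ρ hL U U' m hq', norm_zero]
  calc ∑ q, ‖(wilsonDirac ρ U m 1 - wilsonDirac ρ U' m 1) p q‖
      = ∑ q ∈ univ.filter (fun q : TorusSite 4 L × Fin N × Fin 4 => p.1 ≠ q.1),
            ‖(wilsonDirac ρ U m 1 - wilsonDirac ρ U' m 1) p q‖ +
          ∑ q ∈ univ.filter (fun q : TorusSite 4 L × Fin N × Fin 4 => ¬ p.1 ≠ q.1),
            ‖(wilsonDirac ρ U m 1 - wilsonDirac ρ U' m 1) p q‖ :=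
        (Finset.sum_filter_add_sum_filter_not _ _ _).symm
    _ ≤ 32 * N + 32 * N + 0 := add_le_add hoff hon.le
    _ = 64 * N := by ring

end DefectRowSum

open Literature.Probability.LatticeModels

/-- **Row-sum bound of the defect perturbation** (stub `wilsonDirac_sub_rowSum_le` of line `Sketch`):
for a unitary representation `ρ`, `L ≥ 2`, two gauge fields `U, U'`, a common mass `m` and `r = 1`,
every absolute row sum of `D_W[U] − D_W[U']` is at most `64 N`. -/
theorem wilsonDirac_sub_rowSum_le :
    ∀ (N L : ℕ) [NeZero L] (G : Type) [Group G] (ρ : G →* Matrix (Fin N) (Fin N) ℂ),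
      (∀ g, ρ g ∈ Matrix.unitaryGroup (Fin N) ℂ) → 2 ≤ L →
        ∀ (U U' : GaugeConfig 4 L G) (m : ℝ) (p : TorusSite 4 L × Fin N × Fin 4),
          ∑ q, ‖(wilsonDirac ρ U m 1 - wilsonDirac ρ U' m 1) p q‖ ≤ 64 * N :=
  fun _ _ _ _ _ ρ hρ hL U U' m p => DefectRowSum.wilsonDirac_sub_rowSum_le' ρ hρ hL U U' m p

end Summit.QuantumFields.QCD.Cruxes.StableActionBridge.Sketch

end
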